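import Literature.AlgebraicGeometry.Motives.CartierDivisorCocycleAction
import HarnessLib

/-!
# Sections of `ι^*𝒪_X(D)`: restriction along morphisms over `X`, and the sections defined by
# rational functions

Two further pieces of the chart calculus of `Motives/CartierDivisorCocycle`
(`CartierDivisor.SectionAlong D ι`: global sections of `ι^*𝒪_X(D)` along a morphism `ι : X' → X`,
as families `σ_i ∈ Γ(ι⁻¹U_i, 𝒪_{X'})` with `σ_i = ι^*(f_i/f_j) σ_j`), both PROVED with Mathlib
primitives and needed for Step (II) of the proof of Görtz–Wedhorn II, Lemma 24.72 (the theorem of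
the cube), where a germ of `f_*𝒪(D)` is compared with a compatible family of sections on the
infinitesimal neighbourhoods `X_n ↪ X_{n+1} ↪ ⋯ → X` of a fibre:

* `SectionAlong.restrict s φ e` — restriction of a section along a morphism `φ : X'' → X'` **over
  `X`** (`e : φ ≫ ι = ι'`) to a section of `ι'^*𝒪_X(D)`; this is `SectionAlong.comp` (the case
  `ι' = φ ≫ ι`) without a cast along `e` (`restrict_rfl`), so that "`σ_{n+1}|_{X_n} = σ_n`" can be
  said for the given structure maps `X_n → X`; with `Trivialization.restrict`,
  `TrivialAlong.restrict` and the compatibility with scaling `restrict_scale`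
  (`φ^*(a · s) = φ^*(a) · φ^*(s)`, cf. `scale_comp` of `Motives/CartierDivisorCocycleAction`);
* `SectionAlong.ofRegular D V s hs ι hι` — the section of `ι^*𝒪_X(D)` defined by a rational
  function `s ∈ K(X)` which is a section of `𝒪_X(D)` over an open `V ⊆ X` (`f_i s` regular on
  `U_i ∩ V`, e.g. `V = π⁻¹U` for `CartierDivisor.IsSectionOver D π U s` of
  `Motives/SeesawCohomologyBaseChange`) along any `ι` landing in `V`: coordinates
  `ι^*(f_i s) ∈ Γ(ι⁻¹U_i, 𝒪_{X'})` (the chart sections `chartSection D V s hs i ∈ Γ(U_i ∩ V, 𝒪_X)`,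
  Görtz–Wedhorn I, (11.9): `Γ(V, 𝒪_X(D)) = {s ∈ K(X) ; f_i s ∈ Γ(U_i ∩ V, 𝒪_X)}`, pulled back);
  independent of `V` (`ofRegular_congr`), compatible with restriction (`ofRegular_restrict`), and —
  the stalk maps of `ι` being local — a coordinate `ι^*(f_i s)` which is a unit forces `f_i s` to be
  a unit of `𝒪_{X, ι(x)}` at every point of the chart (`isUnitAt_of_isUnit_ofRegular_σ`): a section
  of `𝒪_X(D)` whose restriction to `X'` trivialises `ι^*𝒪_X(D)` generates `𝒪_X(D)` along `ι(X')`.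

Mathlib searched (pin): `Scheme.Hom.appLE`, `appLE_map`, `map_appLE`, `appLE_comp_appLE`,
`germ_stalkMap_apply`, `TopCat.Presheaf.germ_res_apply`, `Scheme.mem_basicOpen`,
`isUnit_map_iff` with the `IsLocalHom (f.stalkMap x).hom` instance (all used). In this tree:
`RatFn.sectionOf`/`ofSection` (`Motives/CartierDivisorExtension`), `CartierDivisor.transFun`,
`SectionAlong.comp`, `RatFn.appLE_eq_appLE_of_ofSection_eq` (`Motives/CartierDivisorCocycle`),
`SectionAlong.scale` (`Motives/CartierDivisorCocycleAction`).

## References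

* U. Görtz, T. Wedhorn, *Algebraic Geometry I: Schemes*, 2nd ed. (2020),
  doi:10.1007/978-3-658-30733-2: (11.9), p. 374 (`Γ(V, 𝒪_X(D))`); Prop. 11.15 / Rem. 11.16,
  pp. 368–369 (read via the held copy). [GortzWedhorn2020]
* U. Görtz, T. Wedhorn, *Algebraic Geometry II* (2023), doi:10.1007/978-3-658-43031-3:
  Lemma 24.72, proof, Step (II), p. 549. [GortzWedhorn2023]
-/

universe u

open CategoryTheory AlgebraicGeometry TopologicalSpace Opposite

noncomputable section

namespace Literature.AlgebraicGeometry.Motives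

namespace CartierDivisor

open RatFn

variable {X X' X'' : Scheme.{u}} [IsIntegral X] {D : CartierDivisor X} {ι : X' ⟶ X} {ι' : X'' ⟶ X}

/-! ### Restriction of sections along a morphism over `X` -/

omit [IsIntegral X] in
/-- If `φ ≫ ι = ι'` then `ι'⁻¹U ⊆ φ⁻¹(ι⁻¹U)` (equality, in fact). [folklore] -/
theorem preimage_le_preimage_of_comp_eq (φ : X'' ⟶ X') (e : φ ≫ ι = ι') (U : X.Opens) :
    ι' ⁻¹ᵁ U ≤ φ ⁻¹ᵁ (ι ⁻¹ᵁ U) := by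
  subst e; exact le_rfl

namespace SectionAlong

/-- **Restriction of a section of `ι^*𝒪_X(D)` along a morphism `φ : X'' → X'` over `X`**
(`φ ≫ ι = ι'`): the section `φ^*s` of `ι'^*𝒪_X(D) = φ^*ι^*𝒪_X(D)` with coordinates `φ^*(σ_i)` on
`ι'⁻¹U_i`. For `ι' = φ ≫ ι` this is `SectionAlong.comp` (`restrict_rfl`). [folklore] -/
def restrict (s : D.SectionAlong ι) (φ : X'' ⟶ X') (e : φ ≫ ι = ι') : D.SectionAlong ι' where
  σ i := φ.appLE (ι ⁻¹ᵁ D.U i) (ι' ⁻¹ᵁ D.U i) (preimage_le_preimage_of_comp_eq φ e _) (s.σ i)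
  cocycle i j := by subst e; exact (s.comp φ).cocycle i j

/-- The coordinates of a restricted section. [folklore] -/
@[simp]
theorem restrict_σ (s : D.SectionAlong ι) (φ : X'' ⟶ X') (e : φ ≫ ι = ι') (i : D.ι) :
    (s.restrict φ e).σ i =
      φ.appLE (ι ⁻¹ᵁ D.U i) (ι' ⁻¹ᵁ D.U i) (preimage_le_preimage_of_comp_eq φ e _) (s.σ i) := rfl

/-- Restriction along `φ` to `φ ≫ ι` itself is `comp`. [folklore] -/
theorem restrict_rfl (s : D.SectionAlong ι) (φ : X'' ⟶ X') : s.restrict φ rfl = s.comp φ := rfl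

/-- Restriction is compatible with scaling by global functions: `φ^*(a · s) = φ^*(a) · φ^*(s)`.
[folklore] -/
theorem restrict_scale (a : Γ(X', ⊤)) (s : D.SectionAlong ι) (φ : X'' ⟶ X') (e : φ ≫ ι = ι') :
    (s.scale a).restrict φ e = (s.restrict φ e).scale (φ.appTop a) := by
  subst e; exact scale_comp a s φ

/-- Restricting along `φ` and then along `ψ` is restricting along `ψ ≫ φ`. [folklore] -/
theorem restrict_restrict {X''' : Scheme.{u}} {ι'' : X''' ⟶ X} (s : D.SectionAlong ι)
    (φ : X'' ⟶ X') (e : φ ≫ ι = ι') (ψ : X''' ⟶ X'') (e' : ψ ≫ ι' = ι'') :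
    (s.restrict φ e).restrict ψ e' = s.restrict (ψ ≫ φ) (by rw [Category.assoc, e, e']) := by
  ext i
  simp only [restrict_σ]
  rw [← CommRingCat.comp_apply, Scheme.Hom.appLE_comp_appLE]

end SectionAlong

namespace Trivialization

/-- **Restriction of a trivialisation along a morphism over `X`** (units pull back to units).
[folklore] -/
def restrict (τ : D.Trivialization ι) (φ : X'' ⟶ X') (e : φ ≫ ι = ι') : D.Trivialization ι' where
  toSectionAlong := τ.toSectionAlong.restrict φ e
  isUnit i := (τ.isUnit i).map _

/-- The section underlying a restricted trivialisation. [folklore] -/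
@[simp]
theorem restrict_toSectionAlong (τ : D.Trivialization ι) (φ : X'' ⟶ X') (e : φ ≫ ι = ι') :
    (τ.restrict φ e).toSectionAlong = τ.toSectionAlong.restrict φ e := rfl

/-- Restriction is compatible with scaling by global units. [folklore] -/
theorem restrict_scale (u : Γ(X', ⊤)ˣ) (τ : D.Trivialization ι) (φ : X'' ⟶ X') (e : φ ≫ ι = ι') :
    (τ.scale u).restrict φ e = (τ.restrict φ e).scale (Units.map φ.appTop.hom.toMonoidHom u) := by
  cases τ
  simp only [restrict, scale, SectionAlong.restrict_scale]
  rfl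

end Trivialization

/-- Triviality of `ι^*𝒪_X(D)` passes to `ι'^*𝒪_X(D)` for `ι' = φ ≫ ι`. [folklore] -/
theorem TrivialAlong.restrict (h : D.TrivialAlong ι) (φ : X'' ⟶ X') (e : φ ≫ ι = ι') :
    D.TrivialAlong ι' :=
  ⟨h.some.restrict φ e⟩

/-! ### The section of `ι^*𝒪_X(D)` defined by a rational section of `𝒪_X(D)` over an open `V` -/

section OfRegular

variable (D)
variable (V : X.Opens) (s : X.functionField)
  (hs : ∀ (i : D.ι) (x : X), x ∈ D.U i → x ∈ V → IsRegularAt x (D.f i * s))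

open scoped Classical in
/-- **The chart sections `f_i s ∈ Γ(U_i ∩ V, 𝒪_X)` of a rational function `s` which is a section
of `𝒪_X(D)` over `V`** (`f_i s` regular on `U_i ∩ V`; Görtz–Wedhorn I, (11.9):
`Γ(V, 𝒪_X(D)) = {s ∈ K(X) ; f_i s ∈ Γ(U_i ∩ V, 𝒪_X) for all i}`), the section with rational
function `f_i s` (`RatFn.sectionOf`); junk value `0` over an empty `U_i ∩ V`.
[cite: GortzWedhorn2020, Section (11.9) (p. 374)] -/
def chartSection (i : D.ι) : Γ(X, D.U i ⊓ V) :=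
  if h : genericPoint X ∈ D.U i ⊓ V then sectionOf h (D.f i * s) (fun x hx => hs i x hx.1 hx.2)
  else 0

variable {D V s hs}

/-- The rational function of the chart section is `f_i s`. [folklore] -/
@[simp]
theorem ofSection_chartSection {i : D.ι} (h : genericPoint X ∈ D.U i ⊓ V) :
    ofSection h (chartSection D V s hs i) = D.f i * s := by
  unfold chartSection
  rw [dif_pos h, ofSection_sectionOf]

/-- **The cocycle relation of the chart sections**: `f_i s = (f_i/f_j) (f_j s)` on `U_i ∩ U_j ∩ V`.
[folklore] -/
theorem map_chartSection_eq (i j : D.ι) :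
    X.presheaf.map (homOfLE (fun _ hx => ⟨hx.1.1, hx.2⟩ : D.U i ⊓ D.U j ⊓ V ≤ D.U i ⊓ V)).op
        (chartSection D V s hs i) =
      X.presheaf.map (homOfLE (inf_le_left : D.U i ⊓ D.U j ⊓ V ≤ _)).op (D.transFun i j) *
        X.presheaf.map (homOfLE (fun _ hx => ⟨hx.1.2, hx.2⟩ : D.U i ⊓ D.U j ⊓ V ≤ D.U j ⊓ V)).op
          (chartSection D V s hs j) :=
  section_ext fun h => by
    simp only [map_mul, ofSection_map]
    rw [ofSection_chartSection, ofSection_transFun, ofSection_chartSection]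
    field_simp [D.f_ne_zero j]

variable (D V s hs)

/-- **The section of `ι^*𝒪_X(D)` defined by a rational section `s` of `𝒪_X(D)` over `V`, along a
morphism `ι : X' → X` landing in `V`**: coordinates `ι^*(f_i s) ∈ Γ(ι⁻¹U_i, 𝒪_{X'})` (the
restriction `s|_{X'} ∈ H⁰(X', ι^*𝒪_X(D))` of `s ∈ Γ(V, 𝒪_X(D))`; for `V = f⁻¹U` this is the map
`(f_*𝒪(D))(U) → H⁰(X_n, 𝒪(D)|_{X_n})` of the theorem on formal functions, Görtz–Wedhorn II,
Thm. 24.42 / Lemma 24.72, Step (II)). [folklore] -/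
def SectionAlong.ofRegular (ι : X' ⟶ X) (hι : ∀ x : X', ι x ∈ V) : D.SectionAlong ι where
  σ i := ι.appLE (D.U i ⊓ V) (ι ⁻¹ᵁ D.U i) (fun x hx => ⟨hx, hι x⟩) (chartSection D V s hs i)
  cocycle i j := by
    -- both sides are `ι^*` of sections over `U_i ∩ U_j ∩ V` with the same rational function
    have eW : ι ⁻¹ᵁ D.U i ⊓ ι ⁻¹ᵁ D.U j ≤ ι ⁻¹ᵁ (D.U i ⊓ D.U j ⊓ V) :=
      fun x hx => ⟨⟨hx.1, hx.2⟩, hι x⟩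
    rw [← CommRingCat.comp_apply, Scheme.Hom.appLE_map, ← CommRingCat.comp_apply
      (ι.appLE (D.U j ⊓ V) _ _), Scheme.Hom.appLE_map]
    rw [appLE_eq_appLE_of_ofSection_eq ι _ eW (chartSection D V s hs i)
      (X.presheaf.map (homOfLE (fun _ hx => ⟨hx.1.1, hx.2⟩ : D.U i ⊓ D.U j ⊓ V ≤ D.U i ⊓ V)).op
        (chartSection D V s hs i)) (fun hW => by rw [ofSection_map]),
      map_chartSection_eq, map_mul]
    congr 1
    · exact appLE_eq_appLE_of_ofSection_eq ι _ _ _ _ fun hW => by rw [ofSection_map]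
    · exact appLE_eq_appLE_of_ofSection_eq ι _ _ _ _ fun hW => by rw [ofSection_map]

variable {D V s hs}

/-- The coordinates of `SectionAlong.ofRegular`. [folklore] -/
@[simp]
theorem SectionAlong.ofRegular_σ (ι : X' ⟶ X) (hι : ∀ x : X', ι x ∈ V) (i : D.ι) :
    (SectionAlong.ofRegular D V s hs ι hι).σ i =
      ι.appLE (D.U i ⊓ V) (ι ⁻¹ᵁ D.U i) (fun x hx => ⟨hx, hι x⟩) (chartSection D V s hs i) := rfl

/-- **`SectionAlong.ofRegular` does not depend on the open `V`** over which `s` is known to be a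
section (the chart sections have the same rational functions `f_i s`). [folklore] -/
theorem SectionAlong.ofRegular_congr {V' : X.Opens}
    {hs' : ∀ (i : D.ι) (x : X), x ∈ D.U i → x ∈ V' → IsRegularAt x (D.f i * s)}
    (ι : X' ⟶ X) (hι : ∀ x : X', ι x ∈ V) (hι' : ∀ x : X', ι x ∈ V') :
    SectionAlong.ofRegular D V s hs ι hι = SectionAlong.ofRegular D V' s hs' ι hι' := by
  ext i
  exact appLE_eq_appLE_of_ofSection_eq ι _ _ _ _ fun hW => by
    rw [ofSection_chartSection, ofSection_chartSection]

/-- **`SectionAlong.ofRegular` is compatible with restriction** along morphisms over `X`: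
`(s|_{X'})|_{X''} = s|_{X''}`. [folklore] -/
theorem SectionAlong.ofRegular_restrict (ι : X' ⟶ X) (hι : ∀ x : X', ι x ∈ V) (φ : X'' ⟶ X')
    (e : φ ≫ ι = ι') (hι' : ∀ x : X'', ι' x ∈ V) :
    (SectionAlong.ofRegular D V s hs ι hι).restrict φ e = SectionAlong.ofRegular D V s hs ι' hι' := by
  subst e
  ext i
  simp only [SectionAlong.restrict_σ, SectionAlong.ofRegular_σ]
  rw [← CommRingCat.comp_apply, Scheme.Hom.appLE_comp_appLE]

/-- **A rational section of `𝒪_X(D)` whose restriction to `X'` has a unit coordinate generates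
`𝒪_X(D)` along the chart**: if `ι^*(f_i s) ∈ Γ(ι⁻¹U_i, 𝒪_{X'})` is a unit then `f_i s ∈ 𝒪_{X,ι(x)}^×`
for every `x ∈ ι⁻¹U_i` (the germ of `ι^*(f_i s)` at `x` is the image of the germ of `f_i s` at
`ι(x)` under the local homomorphism `𝒪_{X,ι(x)} → 𝒪_{X',x}`). In particular a section of `𝒪_X(D)`
restricting to a trivialisation of `ι^*𝒪_X(D)` is nonvanishing at every point of `ι(X')`
(`CartierDivisor.nonvanishing`). [folklore] -/
theorem isUnitAt_of_isUnit_ofRegular_σ (ι : X' ⟶ X) (hι : ∀ x : X', ι x ∈ V) {i : D.ι}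
    (hu : IsUnit ((SectionAlong.ofRegular D V s hs ι hι).σ i)) {x : X'} (hx : x ∈ ι ⁻¹ᵁ D.U i) :
    IsUnitAt (ι x) (D.f i * s) := by
  have hιx : ι x ∈ D.U i ⊓ V := ⟨hx, hι x⟩
  -- the germ of `ι^*(f_i s)` at `x` is a unit, and it is the image of the germ of `f_i s` at `ι x`
  have h1 : IsUnit (X'.presheaf.germ (ι ⁻¹ᵁ D.U i) x hx
      ((SectionAlong.ofRegular D V s hs ι hι).σ i)) := hu.map _
  have h2 : X'.presheaf.germ (ι ⁻¹ᵁ D.U i) x hx ((SectionAlong.ofRegular D V s hs ι hι).σ i) =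
      ι.stalkMap x (X.presheaf.germ (D.U i ⊓ V) (ι x) hιx (chartSection D V s hs i)) := by
    rw [SectionAlong.ofRegular_σ, Scheme.Hom.germ_stalkMap_apply, Scheme.Hom.appLE,
      CommRingCat.comp_apply, TopCat.Presheaf.germ_res_apply]
  rw [h2] at h1
  have h3 := (isUnit_map_iff (ι.stalkMap x).hom _).1 h1
  have h4 : ι x ∈ X.basicOpen (chartSection D V s hs i) := (X.mem_basicOpen _ _ hιx).2 h3
  have h5 := (isUnitAt_ofSection_iff hιx (chartSection D V s hs i)).2 h4
  rwa [show ofSection (genericPoint_mem_of_mem hιx) (chartSection D V s hs i) =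
    ofSection (genericPoint_mem_of_mem hιx : genericPoint X ∈ D.U i ⊓ V) (chartSection D V s hs i)
    from rfl, ofSection_chartSection] at h5

end OfRegular

end CartierDivisor

end Literature.AlgebraicGeometry.Motives

end
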